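import Summits.CriticalPhenomena.CardyFormulaZ2.Theorems.CardyWhiteToColouredNoiseDiscretisationCrossing

/-!
# Crossings of `R̄` by super-level sets of a continuous field (part 2): discrete ⇒ continuum

Helper file for item `NoiseDiscretisation` (stmt-CriticalPhenomena-4598) of route
`CardyWhiteToColoured` (`CardyFormulaZ2`); continuation of
`CardyWhiteToColouredNoiseDiscretisationCrossing.lean`.

`posCrossing_of_discreteCrossing`: let `R = (Ω; arcs 0–3)` be a conformal rectangle, `F`
continuous on the plane and `a < b`. For all small `δ > 0` (uniform continuity of `F` on the
compact `closure Ω` at precision `b − a` over distances `< 2δ`, and `3δ ≤ dist(arc 0, arc 2)`), if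
a bond configuration `ω` all of whose open inner edges `e` have `F(m_δ e) > b` realises Smirnov's
crossing event `discreteCrossing Ω δ (arc 0) (arc 2)`, then `PosCross[R, F, a]`: the open walk
of `Ω_δ` between the two discrete arcs is read as a polyline of closed mesh edges (inside `Ω̄`,
each point within `δ/2` of the midpoint of its edge), and completed at both ends by the segment
(inside `Ω̄`, of length `≤ δ`) from the arc vertex to its nearest point on the arc; every point of
the resulting path is within `3δ/2` of the midpoint of an open edge of `Ω_δ`, where `F > b`.

References: S. Smirnov, C. R. Acad. Sci. Paris 333 (2001), §2; V. Beffara, D. Gayet, Publ. IHÉS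
126 (2017), §1.
-/

noncomputable section

namespace Summit.CriticalPhenomena.CardyFormulaZ2.Theorems

namespace WhiteToColoured

open Set Metric Filter Topology
open Literature.Probability.LatticeModels Literature.Probability.Percolation
open Literature.Probability.RandomPlanarGeometry

/-- `PosCross[R, F, c]`: some path in `closure R.carrier` from `arc 0` to `arc 2` has `F > c`. -/
local notation3 "PosCross[" R ", " F ", " c "]" =>
  ∃ x ∈ MarkedDomain.arc R (0 : Fin 4), ∃ y ∈ MarkedDomain.arc R (2 : Fin 4), ∃ γ : Path x y,
    ∀ t, γ t ∈ closure (JordanDomain.carrier (MarkedDomain.toJordanDomain R)) ∧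
      (c : ℝ) < (F : ℂ → ℝ) (γ t)

/-- `InnerE[Ω, δ]`: the inner lattice edges at mesh `δ` (both mesh end-points in `Ω`). -/
local notation3 "InnerE[" Ω ", " δ "]" =>
  {e : Sym2 (Site 2) | e ∈ (zdGraph 2).edgeSet ∧ ∀ v ∈ e, meshPoint δ v ∈ (Ω : Set ℂ)}

/-- Two opposite discrete arcs are disjoint once `3δ ≤ dist(arc 0, arc 2)`: a vertex of the
discrete arc of `arc 0` and one of `arc 2` are distinct. -/
theorem ne_of_mem_discreteArc (R : ConformalRectangle) {ε δ : ℝ} (hδ : 0 < δ)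
    (hε : ∀ p ∈ R.arc 0, ∀ q ∈ R.arc 2, ε < dist p q) (hδε : 3 * δ ≤ ε) {x y : Site 2}
    (hx : x ∈ discreteArc R.carrier δ (R.arc 0)) (hy : y ∈ discreteArc R.carrier δ (R.arc 2)) :
    x ≠ y := by
  rintro rfl
  obtain ⟨p, hp, hpd, -⟩ := exists_mem_arc_segment_subset R 0 hδ hx
  obtain ⟨q, hq, hqd, -⟩ := exists_mem_arc_segment_subset R 2 hδ hy
  have := hε p hp q hq
  linarith [dist_triangle p (meshPoint δ x) q, dist_comm p (meshPoint δ x)]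

/-- The midpoint `(u + v)/2` lies on the segment `[u, v]`. -/
theorem add_div_two_mem_segment (u v : ℂ) : (u + v) / 2 ∈ segment ℝ u v := by
  rw [segment_eq_image_lineMap]
  refine ⟨1 / 2, ⟨by norm_num, by norm_num⟩, ?_⟩
  rw [AffineMap.lineMap_apply_module]
  simp only [Complex.real_smul]
  push_cast
  ring

/-- **Discrete ⇒ continuum with a margin.** See the module docstring. -/
theorem posCrossing_of_discreteCrossing (R : ConformalRectangle) {F : ℂ → ℝ} (hF : Continuous F)
    {a b : ℝ} (hab : a < b) :
    ∃ δ₁ > 0, ∀ δ : ℝ, 0 < δ → δ < δ₁ → ∀ ω : BondConfig (Site 2),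
      (∀ e ∈ ω, e ∈ InnerE[R.carrier, δ] → b < F (medialPoint δ e)) →
      ω ∈ discreteCrossing R.carrier δ (R.arc 0) (R.arc 2) → PosCross[R, F, a] := by
  set Ω := R.carrier with hΩdef
  have hK : IsCompact (closure Ω) := R.isBounded.isCompact_closure
  -- uniform continuity of `F` on `closure Ω`
  obtain ⟨ρ, hρ, hρF⟩ : ∃ ρ > 0, ∀ u ∈ closure Ω, ∀ v ∈ closure Ω, dist u v < ρ →
      dist (F u) (F v) < b - a :=
    Metric.uniformContinuousOn_iff.1 (hK.uniformContinuousOn_of_continuous hF.continuousOn)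
      (b - a) (by linarith)
  obtain ⟨ε, hε, hεd⟩ := R.exists_pos_forall_lt_dist_arc
  refine ⟨min (ρ / 2) (ε / 3), by positivity, ?_⟩
  intro δ hδ hδlt ω hopen hcross
  have hδρ : 2 * δ < ρ := by linarith [hδlt.trans_le (min_le_left _ _)]
  have hδε : 3 * δ ≤ ε := by linarith [hδlt.trans_le (min_le_right _ _)]
  -- the super-level set inside `Ω̄`
  set S : Set ℂ := {z | z ∈ closure Ω ∧ a < F z} with hS
  set H := openGraph ω ⊓ discreteDomainGraph Ω δ with hH
  -- `F > a` at every point of `Ω̄` within `3δ/2` of the midpoint of an open edge of `Ω_δ`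
  have hnear : ∀ p q, H.Adj p q → ∀ z ∈ closure Ω,
      dist z (medialPoint δ s(p, q)) ≤ 3 * δ / 2 → z ∈ S := by
    intro p q hpq z hz hzd
    obtain ⟨he, hei, hseg, hzd'⟩ := inner_of_adj hpq
    refine ⟨hz, ?_⟩
    have hb : b < F (medialPoint δ s(p, q)) := hopen _ he hei
    have hm : medialPoint δ s(p, q) ∈ closure Ω := by
      rw [medialPoint_mk]
      exact hseg (add_div_two_mem_segment _ _)
    have hd : dist (F z) (F (medialPoint δ s(p, q))) < b - a :=
      hρF z hz _ hm (by linarith)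
    rw [Real.dist_eq] at hd
    linarith [abs_lt.1 hd]
  -- the closed mesh segment of an open edge of `Ω_δ` lies in `S`
  have hsegS : ∀ p q, H.Adj p q → segment ℝ (meshPoint δ p) (meshPoint δ q) ⊆ S := by
    intro p q hpq z hz
    obtain ⟨-, -, hseg, hzd⟩ := inner_of_adj hpq
    exact hnear p q hpq z (hseg hz) ((dist_medialPoint_le_of_mem_segment hδ hzd hz).trans
      (by linarith))
  -- joining distinct end-points of an `H`-walk inside `S`
  have hjoin : ∀ p q, H.Reachable p q → p ≠ q → JoinedIn S (meshPoint δ p) (meshPoint δ q) := by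
    intro p q hpq
    obtain ⟨W⟩ := hpq
    induction W with
    | nil => intro h; exact absurd rfl h
    | @cons u v w hadj W' ih =>
      intro _
      have h1 : JoinedIn S (meshPoint δ u) (meshPoint δ v) :=
        JoinedIn.of_segment_subset (hsegS u v hadj)
      by_cases hvw : v = w
      · subst hvw; exact h1
      · exact h1.trans (ih hvw)
  -- a reachability relation with distinct end-points starts with an edge
  have hfirst : ∀ {p q : Site 2}, H.Reachable p q → p ≠ q → ∃ w, H.Adj p w := by
    intro p q h hpq
    obtain ⟨W⟩ := h
    cases W with
    | nil => exact absurd rfl hpq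
    | cons hadj _ => exact ⟨_, hadj⟩
  -- the crossing
  obtain ⟨x, hx, y, hy, hxy⟩ := hcross
  have hne : x ≠ y := ne_of_mem_discreteArc R hδ hεd hδε hx hy
  -- the end segments
  have hend : ∀ (i : Fin 4) (v : Site 2), v ∈ discreteArc Ω δ (R.arc i) → (∃ w, H.Adj v w) →
      ∃ a₀ ∈ R.arc i, JoinedIn S a₀ (meshPoint δ v) := by
    rintro i v hv ⟨w, hvw⟩
    obtain ⟨a₀, ha₀, hda₀, hsub⟩ := exists_mem_arc_segment_subset R i hδ hv
    refine ⟨a₀, ha₀, (JoinedIn.of_segment_subset fun z hz => ?_).symm⟩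
    obtain ⟨-, -, hseg, hzd⟩ := inner_of_adj hvw
    refine hnear v w hvw z (hsub hz) ?_
    calc dist z (medialPoint δ s(v, w))
        ≤ dist z (meshPoint δ v) + dist (meshPoint δ v) (medialPoint δ s(v, w)) := dist_triangle _ _ _
      _ ≤ δ + δ / 2 := by
          gcongr
          · rw [dist_comm]; exact (dist_le_of_mem_segment_left hz).trans hda₀
          · exact dist_medialPoint_le_of_mem_segment hδ hzd (left_mem_segment ℝ _ _)
      _ = 3 * δ / 2 := by ring
  obtain ⟨a₀, ha₀, hja⟩ := hend 0 x hx (hfirst hxy hne)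
  obtain ⟨a₂, ha₂, hjb⟩ := hend 2 y hy (hfirst hxy.symm hne.symm)
  exact posCross_iff_joinedIn.2
    ⟨a₀, ha₀, a₂, ha₂, (hja.trans (hjoin x y hxy hne)).trans hjb.symm⟩

end WhiteToColoured

end Summit.CriticalPhenomena.CardyFormulaZ2.Theorems
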